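import Literature.MathematicalPhysics.QuantumFieldTheory.Balaban1983to89.B15BasicStep

/-!
# `Balaban1983to89.B15Sect1Statements` — B15 §1 pp. 200–202: the basic large-field operation 𝐑′ of (1.100) AS AN
OBJECT (its full nested skeleton: the sum over admissible `Z_k`, the operations `𝕋″_k(Z_k)`, the sum over the
component families `{X_1,…,X_n}`, the product over components of the averaged, normalized small-field INSERTS with the
χ of (1.101), acting on `exp A″_k`), the equivalence (1.99) it starts from, and its normalization property (1.102)

statement-level skeleton of published theorems with citation tags; proofs where landed; nothing here is a claim about
the Yang–Mills mass gap.

CITATION HEADER (lean-in-tree rule 2026-08-18).  T. Bałaban, *Large field renormalization. I. The basic step of the 𝐑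
operation*, Commun. Math. Phys. **122**, 175–202 (1989), doi:10.1007/BF01257412, bib `Balaban1989LargeFieldI` (cell
paper B15; PDF held `paper:balaban1989-cmp122-large-field-i`, journal page = PDF page + 174).  Every quotation below was
READ AS AN IMAGE on the x2 renders `run/shared/lean/pub/pub-balaban/b2b-balaban-ref1/pages/1989-cmp122-large-field-I/
…-p026-x2.png, …-p027-x2.png, …-p028-x2.png` (pp. 200–202), not on the OCR layer.  The paper is a manuscript under
adjudication by the audit cell `pub-balaban`; NOTHING printed in it is asserted here as a fact: (1.100) enters as a
DEFINITION (an `ℝ`-valued density assembled from explicitly named data), (1.99) and (1.102) as PARAMETERISED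
`def … : Prop` leaves, and the `theorem`s are bookkeeping (unfoldings; the identification of one factor of (1.100) with
the normalized term `B15.BasicStep.normTerm` of (0.3); the reduction of (1.102) for the OPERATOR to (1.102) for the
object; and (1.102) PROVED for the one-component instance from `B15.BasicStep.integral_normTerm_eq` under the printed
provisos), no `sorry`, no new axioms.

WHY THIS MODULE (mega-formalization `lit-balaban`, reader/typer r12 = owner of block B15; lead row `B15.Obj1.100`,
INTERFACES.md §1.1 NE1′ PULL P1, `b2b-balaban-t4-dagwriter` 2026-08-20T22:21:17Z: *"NEED: B15 (1.99)–(1.100) R′ as an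
OBJECT (+ (1.101)–(1.102)) — the one printed NE1′-side statement the DAG knows to have no decl"*).  What the tree had:
the display-wise pieces — `B15.BasicStep.normTerm`/`RopReal`/`fibreIntegral` (ONE normalized term `new·∫⌈old/∫⌈new` and
the flat sum (0.3), with (0.4)/(1.102)-per-term PROVED as `integral_normTerm_eq`/`integral_ropReal_eq`),
`B15.BasicStep.Chi101` ((1.101) as a predicate on `log V′`), `B15.BasicStep.Eq1102` ((1.102) for an operator on
densities), `B15.BasicStep.Nwt` (the printed `N_i`), `B16GaugeClassTransport.gaugeAvg` (the averaging shape), and the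
cell-side two-family form `T4DressedR.Rop2`/`RopRealIn`.  None of them carries the NESTED structure printed in (1.100) —
regions `Z_k` ▸ operations `𝕋″_k(Z_k)` ▸ families `{X_i}` with `χ_k(Ω_k^{∼4})` ▸ per component the weight `1/N_i`, the
sum over the localized data `({Ω^c_{i,j}, Z_{i,j}}, G_i, T_i)`, the factor `χ_{k,Λ_i}`, the INSERT
`δ_{G_i}(V′_k)χ(Λ_i)exp[−g_k⁻²A(ζ_i, U_{k,X_i}(V′_kV_{Λ_i}))]` over its own `∫dV′⌈_{Λ_i}`, and the old localized integral
operation `∫dV_h⌈… χ_{h,1/2}(…)𝕋_h(Z_{i,h})∫dV′⌈_{𝔹_i}δ_{T_i}(V′)χ′_i[·]` ▸ all acting on `exp A″_k` — which is what a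
consumer quoting "the KIND of 𝐑′" needs.  This module types exactly that skeleton over the tree's `Setup` carrier
(`Density P k G = GaugeField P k G → ℝ`, `fieldMeasure` = product of normalized Haar measures, `fibreIntegral` =
`∫dV⌈_Λ`), reusing — not restating — the sibling decls named above.

DICTIONARY / MODELLING CONVENTIONS (the schematic style of the B-family, cell DIVERGENCE D-b01.1–3).  (a) Index sets
the paper sums over (admissible `Z_k`; the forms of `𝕋″_k(Z_k)` = *"summation over {Ω^c_j, Z_j}"*; the families
`{X_1,…,X_n}`; the localized data `({Ω^c_{i,j},Z_{i,j}}, G_i, T_i)`) are abstract FINITE types supplied as data — their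
geometry ((1.6)–(1.23), (1.73), conditions (i)/(ii) p. 177) is not modelled here (`…B16Stage3Regions`, cell STEP.md §7).
(b) The integral OPERATIONS over auxiliary fields (`𝕋″_k(Z_k)` of (1.71)/(1.72)/(1.99), and the localized
`∫dV_h⌈…𝕋_h(Z_{i,h})∫dV′⌈_{𝔹_i}δ_{T_i}(V′)χ′_i[·]`) enter as operators `Density P k G → Density P k G` (the auxiliary
variables `V_h`, `V′` are integrated inside them; what remains is a function of `V_k`).  (c) The insert is typed by its
three printed factors as densities in `V_k` (on `Λ_i` the paper writes the field as `V′_kV_{Λ_i}`, `V_{Λ_i}` = the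
minimizer of Proposition 1 (`B15.Prop1Printed`), a function of `V_k⌈_{Z∩Λᶜ}`; by the invariance of the Haar measure
`dV_k⌈_{Λ_i} = dV′_k⌈_{Λ_i}`, so `∫dV′⌈_{Λ_i}` is `fibreIntegral Λ_i`).  (d) `Π_{i=1}^{n}` of component OPERATORS is
their composition in the printed order (the paper: *"The integrations in (1.99) are also factorized in those
components"*, p. 201 — so the order is immaterial there; nothing of that is asserted here).  (e) The weight is carried as
the printed prefactor `1/N_i` (an explicit real; p. 201 *"Then N_i = 1/(2^dd!)"*, `B15.BasicStep.Nwt`).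
Companion rows: `run/shared/lean/pub/lit-balaban/lit-balaban-r12/ROWS-B15.md` (B15.Eq1.99, B15.Eq1.100, B15.Obj1.100,
B15.Eq1.101, B15.Eq1.102).
-/

open scoped BigOperators
open _root_.MeasureTheory Finset

namespace Literature.MathematicalPhysics.QuantumFieldTheory.Balaban1983to89.B15Sect1Statements

open B15.BasicStep

variable {P : Params} {k : ℕ} {G : Type*}

/-! ## Part A. (1.101) and the small-field INSERT of (1.100) -/

/-- **(1.101)** p. 201 [PDF 27], verbatim: *"χ(Λ_i) = χ({|(1/i) log V′(b)| < M₀ε_k for b∈Λ_i})"* — as a `{0,1}`-valued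
DENSITY in the field (the predicate is the sibling `B15.BasicStep.Chi101`, not restated): `logV' V b` ↤ `|(1/i)log V′(b)|`
read off the configuration `V` (on `Λ_i`, `V′ = V_kV_{Λ_i}⁻¹`), `Λ` ↤ `Λ_i`, `M₀`, `εk` ↤ `M₀` (fixed in [II] (1.69)), `ε_k`.
[cite: Balaban1989LargeFieldI, (1.101) p.201] -/
noncomputable def chi101Density (logV' : GaugeField P k G → PBond P k → ℝ) (Λ : Finset (PBond P k)) (M₀ εk : ℝ) :
    Density P k G := by
  classical
  exact fun V => if Chi101 (logV' V) (↑Λ : Set (PBond P k)) M₀ εk then 1 else 0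

/-- `χ(Λ_i)` takes the values `0` and `1` only. [cite: Balaban1989LargeFieldI, (1.101) p.201] -/
theorem chi101Density_eq_zero_or_one (logV' : GaugeField P k G → PBond P k → ℝ) (Λ : Finset (PBond P k))
    (M₀ εk : ℝ) (V : GaugeField P k G) :
    chi101Density logV' Λ M₀ εk V = 0 ∨ chi101Density logV' Λ M₀ εk V = 1 := by
  unfold chi101Density
  split_ifs <;> simp

variable [GaugeGroup G] [MeasurableSpace G] [HaarData G] [DecidableEq (PBond P k)]

/-- The small-field INSERT of (1.100) p. 201 for one renormalized component, by its printed factors: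
*"δ_{G_i}(V′_k)χ(Λ_i)exp[−(1/g_k²)A(ζ_i, U_{k,X_i}(V′_kV_{Λ_i}))]"* — `lam` ↤ `Λ_i` (the positive bonds whose variables
`V′_k⌈_{Λ_i}` the denominator integrates), `gaugeDelta` ↤ `δ_{G_i}(V′_k)` (*"G_i is a graph in Λ_i fixing the axial gauge"*;
as a nonnegative weight), `chiΛ` ↤ `χ(Λ_i)` of (1.101) (e.g. `chi101Density …`), `gk` ↤ `g_k`, `action V` ↤
`A(ζ_i, U_{k,X_i}(V′_kV_{Λ_i}))` (*"ζ_i∈C₀^∞(X_i), ζ_i changes from 0 to 1 in a neighborhood of ∂X_i^{∼−2}"*; `U_{k,X_i}`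
the background (1.74) of the component, `V_{Λ_i}` the minimizer of Proposition 1 — `B15.Prop1Printed`).
[cite: Balaban1989LargeFieldI, (1.100) p.201] -/
structure Insert1100 (P : Params) (k : ℕ) (G : Type*) [GaugeGroup G] [MeasurableSpace G] [HaarData G] where
  lam : Finset (PBond P k)
  gaugeDelta : Density P k G
  chiΛ : Density P k G
  gk : ℝ
  action : Density P k G

namespace Insert1100

/-- The numerator of the (1.100) quotient: `δ_{G_i}(V′_k)χ(Λ_i)exp[−g_k⁻²A(ζ_i, U_{k,X_i}(V′_kV_{Λ_i}))]`.
[cite: Balaban1989LargeFieldI, (1.100) p.201] -/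
noncomputable def num (I : Insert1100 P k G) : Density P k G :=
  fun V => I.gaugeDelta V * I.chiΛ V * Real.exp (-(1 / I.gk ^ 2) * I.action V)

/-- The denominator of the (1.100) quotient: *"∫dV′⌈_{Λ_i}δ_{G_i}(V′)χ(Λ_i)exp[−(1/g_k²)A(ζ_i, U_{k,X_i}(V′V_{Λ_i}))]"* —
the fibre integral (`B15.BasicStep.fibreIntegral`, `∫dV⌈_{Λ_i}` over the normalized Haar fibres) of the numerator; a
function of the variables off `Λ_i`. [cite: Balaban1989LargeFieldI, (1.100) p.201] -/
noncomputable def den (I : Insert1100 P k G) : Density P k G := fibreIntegral I.lam I.num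

/-- The (1.100) quotient `num/den` — a probability density in the fresh variables `V′_k⌈_{Λ_i}` wherever the denominator is
positive (p. 176: *"the integration domains … are nonempty, hence the denominators are positive"*; real division as
printed, junk value at a vanishing denominator as in `B15.Rop`). [cite: Balaban1989LargeFieldI, (1.100) p.201] -/
noncomputable def ratio (I : Insert1100 P k G) : Density P k G := fun V => I.num V / I.den V

omit [DecidableEq (PBond P k)] in
/-- With `δ_{G_i} ≥ 0` and `χ(Λ_i) ≥ 0` the insert is nonnegative (densities are nonnegative, p. 176). [cite: Balaban1989LargeFieldI, (1.100) p.201] -/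
theorem num_nonneg (I : Insert1100 P k G) (hδ : ∀ V, 0 ≤ I.gaugeDelta V) (hχ : ∀ V, 0 ≤ I.chiΛ V)
    (V : GaugeField P k G) : 0 ≤ I.num V :=
  mul_nonneg (mul_nonneg (hδ V) (hχ V)) (Real.exp_pos _).le

end Insert1100

/-! ## Part B. One renormalized component `X_i`, one family `{X_1,…,X_n}`, the curly bracket, and 𝐑′ (1.100) -/

/-- The data of ONE renormalized component `X_i` in (1.100) p. 201: `Loc` ↤ the finite range of the inner summation
*"{Ω^c_{i,j}, Z_{i,j}}, G_i, T_i"* (the sequences localized in `X_i`, the axial-gauge graph `G_i ⊂ Λ_i`, the gauge-fixing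
tree `T_i`); `weight` ↤ the printed prefactor `1/N_i` (p. 201: *"Then N_i = 1/(2^dd!)"*, `B15.BasicStep.Nwt`); for each
datum `l`: `chiKΛ l` ↤ `χ_{k,Λ_i}` ((1.75), a restriction on `V_k⌈_{Z∩Λ_iᶜ}` only), `ins l` ↤ the insert, `oldOp l` ↤ the
old localized integral operation *"∫dV_h⌈_{(Ω″^{∼2}_{i,h+1})ᶜ}χ_{h,1/2}((Ω″^∼_{i,h+1})ᶜ∩Ω_{i,h})𝕋_h(Z_{i,h})∫dV′⌈_{𝔹_i}
δ_{T_i}(V′)χ′_i [ · ]"* acting on what stands to its right (convention (b) of the module docstring).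
[cite: Balaban1989LargeFieldI, (1.100) p.201] -/
structure Component1100 (P : Params) (k : ℕ) (G : Type*) [GaugeGroup G] [MeasurableSpace G] [HaarData G] where
  Loc : Type
  [fintypeLoc : Fintype Loc]
  weight : ℝ
  chiKΛ : Loc → Density P k G
  ins : Loc → Insert1100 P k G
  oldOp : Loc → Density P k G → Density P k G

attribute [instance] Component1100.fintypeLoc

namespace Component1100

/-- The `i`-th bracket of (1.100) as an OPERATOR on densities: `ρ ↦ (1/N_i) Σ_l χ_{k,Λ_i} · (num_l/den_l) · oldOp_l[ρ]`,
verbatim *"[ (1/N_i) Σ_{{Ω^c_{i,j},Z_{i,j}},G_i,T_i} χ_{k,Λ_i} (δ_{G_i}(V′_k)χ(Λ_i)exp[…]) / (∫dV′⌈_{Λ_i}δ_{G_i}(V′)χ(Λ_i)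
exp[…]) · ∫dV_h⌈…𝕋_h(Z_{i,h})∫dV′⌈_{𝔹_i}δ_{T_i}(V′)χ′_i ]"*. [cite: Balaban1989LargeFieldI, (1.100) p.201] -/
noncomputable def op (C : Component1100 P k G) (ρ : Density P k G) : Density P k G :=
  fun V => C.weight * ∑ l, C.chiKΛ l V * (C.ins l).ratio V * C.oldOp l ρ V

/-- The same bracket WITHOUT the insert quotient — the `i`-th factor of the rearranged (1.99) (p. 201: *"we separate the
summation over the admissible Z_k, n, X_1,…,X_n, from the remaining summations, which are factorized in those domains …
The integrations in (1.99) are also factorized in those components"*; the graph averaging `(1/N_i)Σ_{G_i,T_i}` being over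
equivalent gauge fixings, p. 201). [cite: Balaban1989LargeFieldI, (1.99) p.201] -/
noncomputable def bareOp (C : Component1100 P k G) (ρ : Density P k G) : Density P k G :=
  fun V => C.weight * ∑ l, C.chiKΛ l V * C.oldOp l ρ V

/-- THE LINK TO (0.3): when `χ_{k,Λ_i}` and the integrated old expression do not depend on the variables `V_k⌈_{Λ_i}`
(p. 193: (1.75) restricts `V_k⌈_{Z∩Λᶜ}` only; p. 194: *"a new expression … independent of V_k⌈_Λ"*) — stated in the
tree's vocabulary as `∫dV⌈_{Λ_i}(χ·old) = χ·old` — each term of the bracket IS the normalized term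
`B15.BasicStep.normTerm Λ_i (insert) (χ·old)` of (0.3)/(1.100) (`new·∫⌈old/∫⌈new`). [cite: Balaban1989LargeFieldI, (1.100) p.201] -/
theorem op_eq_sum_normTerm (C : Component1100 P k G) (ρ : Density P k G)
    (hindep : ∀ l V, fibreIntegral (C.ins l).lam (fun U => C.chiKΛ l U * C.oldOp l ρ U) V
      = C.chiKΛ l V * C.oldOp l ρ V) (V : GaugeField P k G) :
    C.op ρ V = C.weight * ∑ l, normTerm (C.ins l).lam (C.ins l).num (fun U => C.chiKΛ l U * C.oldOp l ρ U) V := by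
  unfold op
  congr 1
  refine sum_congr rfl fun l _ => ?_
  simp only [normTerm, hindep l V, Insert1100.ratio, Insert1100.den]
  ring

end Component1100

/-- The data of ONE term of the family sum in the curly bracket of (1.100): `n` ↤ the number of renormalized components
(*"Z = X_1 ∪ ⋯ ∪ X_n"*, `n ≥ 0`), `chiK4` ↤ `χ_k(Ω_k^{∼4})`, `comp i` ↤ the data of `X_i`. [cite: Balaban1989LargeFieldI, (1.100) p.201] -/
structure Family1100 (P : Params) (k : ℕ) (G : Type*) [GaugeGroup G] [MeasurableSpace G] [HaarData G] where
  n : ℕ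
  chiK4 : Density P k G
  comp : Fin n → Component1100 P k G

namespace Family1100

/-- `Π_{i=1}^{n}[ … ]` of (1.100) as the composition, in the printed order, of the component operators (convention (d)).
[cite: Balaban1989LargeFieldI, (1.100) p.201] -/
noncomputable def prodOp (F : Family1100 P k G) : Density P k G → Density P k G :=
  (List.ofFn fun i : Fin F.n => (F.comp i).op).foldr (· ∘ ·) id

/-- The same product for the rearranged (1.99) (no inserts). [cite: Balaban1989LargeFieldI, (1.99) p.201] -/
noncomputable def bareProdOp (F : Family1100 P k G) : Density P k G → Density P k G :=
  (List.ofFn fun i : Fin F.n => (F.comp i).bareOp).foldr (· ∘ ·) id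

/-- `n = 0` (no renormalized component: `Z_k` the only large-field region): the product is the identity.
[cite: Balaban1989LargeFieldI, (1.100) p.201] -/
theorem prodOp_of_n_eq_zero (F : Family1100 P k G) (h : F.n = 0) : F.prodOp = id := by
  obtain ⟨n, chiK4, comp⟩ := F
  subst h
  rfl

/-- `n = 1`: the product is the single component operator. [cite: Balaban1989LargeFieldI, (1.100) p.201] -/
theorem prodOp_one (chiK4 : Density P k G) (C : Component1100 P k G) :
    (Family1100.mk 1 chiK4 fun _ => C).prodOp = C.op := by
  rfl

end Family1100

/-- The data of 𝐑′ (1.100) p. 201 for the `k`-th density: `ZK` ↤ the admissible large-field regions `Z_k` (*"We denote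
Z_k∖Z by Z_k"*); for each `z`: `TT z` ↤ the finite range of *"Σ_{{Ω^c_j,Z_j}}"* (the forms of the operation
`𝕋″_k(Z_k)`, p. 200: *"the integral operations have many forms, varying from the old 𝕋-operations to the integrals as in
(1.76) … These operations are denoted by 𝕋″_k"*), `ttOp z t` ↤ that operation acting on the curly bracket
(convention (b)); `Fam z` ↤ the finite range of *"Σ_{n≥0}Σ_{{X_1,…,X_n}}"*, `fam z f` its data; `expA z` ↤ `exp A″_k`
(`A″_k = A_k + B″_k`, (1.72)). [cite: Balaban1989LargeFieldI, (1.100) p.201] -/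
structure RPrimeData (P : Params) (k : ℕ) (G : Type*) [GaugeGroup G] [MeasurableSpace G] [HaarData G] where
  ZK : Type
  [fintypeZK : Fintype ZK]
  TT : ZK → Type
  [fintypeTT : ∀ z, Fintype (TT z)]
  ttOp : (z : ZK) → TT z → Density P k G → Density P k G
  Fam : ZK → Type
  [fintypeFam : ∀ z, Fintype (Fam z)]
  fam : (z : ZK) → Fam z → Family1100 P k G
  expA : ZK → Density P k G

attribute [instance] RPrimeData.fintypeZK RPrimeData.fintypeTT RPrimeData.fintypeFam

namespace RPrimeData

/-- The curly bracket of (1.100) for the region `Z_k`: *"{ Σ_{n≥0} Σ_{{X_1,…,X_n}} χ_k(Ω_k^{∼4}) Π_{i=1}^{n}[ … ] exp A″_k }"*.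
[cite: Balaban1989LargeFieldI, (1.100) p.201] -/
noncomputable def curly (D : RPrimeData P k G) (z : D.ZK) : Density P k G :=
  fun V => ∑ f, (D.fam z f).chiK4 V * (D.fam z f).prodOp (D.expA z) V

/-- The curly bracket of the rearranged (1.99) (no inserts). [cite: Balaban1989LargeFieldI, (1.99) p.201] -/
noncomputable def bareCurly (D : RPrimeData P k G) (z : D.ZK) : Density P k G :=
  fun V => ∑ f, (D.fam z f).chiK4 V * (D.fam z f).bareProdOp (D.expA z) V

end RPrimeData

/-- **(1.100)** p. 201 [PDF 27] — THE OPERATION 𝐑′ AS AN OBJECT, verbatim: *"(𝐑′ρ_k)(V_k) = Σ_{Z_k}( Σ_{{Ω^c_j,Z_j}}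
𝕋″_k(Z_k) ){ Σ_{n≥0} Σ_{{X_1,…,X_n}} χ_k(Ω_k^{∼4}) Π_{i=1}^{n}[ (1/N_i) Σ_{{Ω^c_{i,j},Z_{i,j}},G_i,T_i} χ_{k,Λ_i} ·
δ_{G_i}(V′_k)χ(Λ_i)exp[−(1/g_k²)A(ζ_i, U_{k,X_i}(V′_kV_{Λ_i}))] / ∫dV′⌈_{Λ_i}δ_{G_i}(V′)χ(Λ_i)exp[−(1/g_k²)A(ζ_i,
U_{k,X_i}(V′V_{Λ_i}))] · ∫dV_h⌈_{(Ω″^{∼2}_{i,h+1})ᶜ}χ_{h,1/2}((Ω″^∼_{i,h+1})ᶜ∩Ω_{i,h})𝕋_h(Z_{i,h})∫dV′⌈_{𝔹_i}δ_{T_i}(V′)χ′_i ]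
exp A″_k }, (1.100) where G_i is a graph in Λ_i fixing the axial gauge, ζ_i∈C₀^∞(X_i), ζ_i changes from 0 to 1 in a
neighborhood of ∂X_i^{∼−2}, and χ(Λ_i) is given by (1.101)"*; p. 201: *"an operation, which is not a complete
𝐑-operation yet, but is a basic part of it"*.  The value at `V_k` of the density assembled from the data `D`.
[cite: Balaban1989LargeFieldI, (1.100) p.201] -/
noncomputable def rPrime1100 (D : RPrimeData P k G) : Density P k G :=
  fun V => ∑ z, ∑ t, D.ttOp z t (D.curly z) V

/-- The right side of **(1.99)** pp. 200–201 [PDF 26–27] in the rearranged form of p. 201, verbatim (1.99): *"ρ_k(V_k) ≡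
Σ_{{Ω_j,Λ_j}} χ_k(Ω_k^{∼4})χ_{k,Λ}𝕋″_k(Z_k∖Z)∫dV_h⌈_{(Ω″^{∼2}_{h+1})ᶜ∩Z}χ_{h,1/2}((Ω″^∼_{h+1})ᶜ∩Ω_h∩Z)𝕋_h(Z_h∩Z)
∫dV′⌈_{𝔹₀}δ_{T₀}(V′)χ′ exp A″_k"* and p. 201: *"Now we rearrange the sum above. We denote Z_k∖Z by Z_k, we write Z
explicitly as a union of components, Z = X_1 ∪ ⋯ ∪ X_n, and we separate the summation over the admissible Z_k, n,
X_1,…,X_n, from the remaining summations, which are factorized in those domains. … The integrations in (1.99) are also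
factorized in those components."* — the same skeleton as (1.100) with every insert quotient removed.
[cite: Balaban1989LargeFieldI, (1.99) p.201] -/
noncomputable def bare199 (D : RPrimeData P k G) : Density P k G :=
  fun V => ∑ z, ∑ t, D.ttOp z t (D.bareCurly z) V

/-- **(1.99)** p. 200, the EQUIVALENCE `ρ_k ≡ …` typed as what the paper says it means (p. 193: *"The equality sign is
replaced by the equivalence sign, the equivalence means that both sides have equal integrals over the space of fields
V_k"*; p. 200: *"We have obtained a density, which may not be equal to ρ_k, but is equivalent to it, in the sense that
they have equal integrals"*): `∫dV_k ρ_k = ∫dV_k (1.99)`. [cite: Balaban1989LargeFieldI, (1.99) p.200] -/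
def Equiv199 (D : RPrimeData P k G) (ρ : Density P k G) : Prop :=
  ∫ V, ρ V ∂(fieldMeasure P k G) = ∫ V, bare199 D V ∂(fieldMeasure P k G)

/-- **(1.102)** p. 201 [PDF 27], verbatim: *"The above operation has the fundamental normalization property
∫dV_k(𝐑′ρ_k)(V_k) = ∫dV_kρ_k(V_k). (1.102) In fact, the 𝐑′-operation changes essentially the initial density ρ_k only in
a neighborhood of the large field region; the changes are decaying exponentially fast with the distance to the region"* —
for the OBJECT `rPrime1100 D` and the density `ρ_k` it renormalizes. [cite: Balaban1989LargeFieldI, (1.102) p.201] -/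
def Normalization1102 (D : RPrimeData P k G) (ρ : Density P k G) : Prop :=
  ∫ V, rPrime1100 D V ∂(fieldMeasure P k G) = ∫ V, ρ V ∂(fieldMeasure P k G)

/-- (1.102) for 𝐑′ as an OPERATOR on densities (`B15.BasicStep.Eq1102`, the form `Setup.PreservesIntegral`/
`Step.DensityRG` consume): if the operator acts on `ρ` through a representation `rep ρ : RPrimeData` by (1.100), then
`Eq1102` for it at `ρ` is `Normalization1102 (rep ρ) ρ`. Bookkeeping. [cite: Balaban1989LargeFieldI, (1.102) p.201] -/
theorem eq1102_iff_normalization1102 (rep : Density P k G → RPrimeData P k G) (ρ : Density P k G) :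
    Eq1102 (fun ρ' => rPrime1100 (rep ρ')) ρ ↔ Normalization1102 (rep ρ) ρ := Iff.rfl

/-- The printed route to (1.102): (1.99) (equal integrals of `ρ_k` and the un-inserted expression) and "each insert
quotient integrates to one over its own fresh variables" (equal integrals of (1.100) and (1.99)) give (1.102).
Bookkeeping (transitivity); the second hypothesis is discharged for the one-component instance below.
[cite: Balaban1989LargeFieldI, (1.102) p.201] -/
theorem normalization1102_of_equiv199 (D : RPrimeData P k G) (ρ : Density P k G) (h199 : Equiv199 D ρ)
    (hins : ∫ V, rPrime1100 D V ∂(fieldMeasure P k G) = ∫ V, bare199 D V ∂(fieldMeasure P k G)) :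
    Normalization1102 D ρ := by
  unfold Normalization1102
  rw [hins, ← h199]

/-! ## Part C. The one-component instance: (1.102) PROVED from the (0.3)/(0.4) mechanism of `B15.BasicStep` -/

/-- The smallest non-trivial instance of the data: ONE region `Z_k`, the operation `𝕋″_k(Z_k)` already performed
(identity on what remains a function of `V_k`), ONE family with ONE renormalized component.
[cite: Balaban1989LargeFieldI, (1.100) p.201] -/
noncomputable def RPrimeData.single (C : Component1100 P k G) (chiK4 expA : Density P k G) : RPrimeData P k G where
  ZK := Unit
  TT := fun _ => Unit
  ttOp := fun _ _ ρ => ρ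
  Fam := fun _ => Unit
  fam := fun _ _ => ⟨1, chiK4, fun _ => C⟩
  expA := fun _ => expA

/-- Unfolding of 𝐑′ on the one-component instance: `(𝐑′ρ_k)(V) = χ_k(Ω_k^{∼4})(V) · [bracket](exp A″_k)(V)`.
[cite: Balaban1989LargeFieldI, (1.100) p.201] -/
theorem rPrime1100_single (C : Component1100 P k G) (chiK4 expA : Density P k G) (V : GaugeField P k G) :
    rPrime1100 (RPrimeData.single C chiK4 expA) V = chiK4 V * C.op expA V := by
  simp [rPrime1100, RPrimeData.single, RPrimeData.curly, Family1100.prodOp]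

omit [DecidableEq (PBond P k)] in
/-- Unfolding of (1.99) on the one-component instance. [cite: Balaban1989LargeFieldI, (1.99) p.201] -/
theorem bare199_single (C : Component1100 P k G) (chiK4 expA : Density P k G) (V : GaugeField P k G) :
    bare199 (RPrimeData.single C chiK4 expA) V = chiK4 V * C.bareOp expA V := by
  simp [bare199, RPrimeData.single, RPrimeData.bareCurly, Family1100.bareProdOp]

/-- **(1.102) PROVED on the one-component instance** from the printed mechanism, i.e. from `B15.BasicStep`'s
`integral_normTerm_eq` ((0.4)/(1.102) for one normalized term): if, for every localized datum `l`, the insert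
`num_l` is measurable, nonnegative and bounded, the factor `χ_k(Ω_k^{∼4})χ_{k,Λ_i}·oldOp_l[exp A″_k]` is measurable,
nonnegative, bounded and independent of the variables `V_k⌈_{Λ_i}` (p. 193/194, in the form `∫dV⌈_{Λ_i}(it) = it`), and
the denominator `∫dV′⌈_{Λ_i} num_l` vanishes nowhere (p. 176: *"the denominators are positive"*), then
`∫dV_k (𝐑′ρ_k) = ∫dV_k (1.99)`; with (1.99) this is (1.102) (`normalization1102_of_equiv199`).
[cite: Balaban1989LargeFieldI, (1.102) p.201] -/
theorem integral_rPrime1100_single (C : Component1100 P k G) (chiK4 expA : Density P k G)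
    (hnum_m : ∀ l, Measurable (C.ins l).num) (hnum0 : ∀ l V, 0 ≤ (C.ins l).num V)
    (hold_m : ∀ l, Measurable fun U => chiK4 U * (C.chiKΛ l U * C.oldOp l expA U))
    (hold0 : ∀ l V, 0 ≤ chiK4 V * (C.chiKΛ l V * C.oldOp l expA V))
    {B : ℝ} (hnumB : ∀ l V, (C.ins l).num V ≤ B) (holdB : ∀ l V, chiK4 V * (C.chiKΛ l V * C.oldOp l expA V) ≤ B)
    (hindep : ∀ l V, fibreIntegral (C.ins l).lam (fun U => chiK4 U * (C.chiKΛ l U * C.oldOp l expA U)) V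
      = chiK4 V * (C.chiKΛ l V * C.oldOp l expA V))
    (hden : ∀ l V, (C.ins l).den V ≠ 0) :
    ∫ V, rPrime1100 (RPrimeData.single C chiK4 expA) V ∂(fieldMeasure P k G)
      = ∫ V, bare199 (RPrimeData.single C chiK4 expA) V ∂(fieldMeasure P k G) := by
  -- each term of 𝐑′ is `weight • normTerm Λ_l num_l (χ_k(Ω^{∼4})χ_{k,Λ}·old_l)`
  have hterm : ∀ l V, chiK4 V * (C.chiKΛ l V * (C.ins l).ratio V * C.oldOp l expA V)
      = normTerm (C.ins l).lam (C.ins l).num (fun U => chiK4 U * (C.chiKΛ l U * C.oldOp l expA U)) V := by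
    intro l V
    simp only [normTerm, hindep l V, Insert1100.ratio, Insert1100.den]
    ring
  have hR : ∀ V, rPrime1100 (RPrimeData.single C chiK4 expA) V
      = ∑ l, C.weight * normTerm (C.ins l).lam (C.ins l).num
          (fun U => chiK4 U * (C.chiKΛ l U * C.oldOp l expA U)) V := by
    intro V
    rw [rPrime1100_single, Component1100.op, mul_sum, mul_sum]
    refine sum_congr rfl fun l _ => ?_
    rw [← hterm l V]; ring
  have hB : ∀ V, bare199 (RPrimeData.single C chiK4 expA) V
      = ∑ l, C.weight * (chiK4 V * (C.chiKΛ l V * C.oldOp l expA V)) := by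
    intro V
    rw [bare199_single, Component1100.bareOp, mul_sum, mul_sum]
    refine sum_congr rfl fun l _ => ?_
    ring
  have hint_old : ∀ l, Integrable (fun V => chiK4 V * (C.chiKΛ l V * C.oldOp l expA V)) (fieldMeasure P k G) := by
    intro l
    refine ⟨(hold_m l).aestronglyMeasurable, ?_⟩
    rw [hasFiniteIntegral_iff_ofReal (Filter.Eventually.of_forall (hold0 l))]
    calc ∫⁻ V, ENNReal.ofReal (chiK4 V * (C.chiKΛ l V * C.oldOp l expA V)) ∂(fieldMeasure P k G)
        ≤ ∫⁻ _V, ENNReal.ofReal B ∂(fieldMeasure P k G) :=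
          lintegral_mono (fun V => ENNReal.ofReal_le_ofReal (holdB l V))
      _ < ⊤ := by simp
  simp_rw [hR, hB]
  rw [integral_finsetSum _ (fun l _ => (integrable_normTerm (C.ins l).lam (hnum_m l) (hold_m l) (hnum0 l)
      (hnumB l) (holdB l) (hden l)).const_mul C.weight),
    integral_finsetSum _ (fun l _ => (hint_old l).const_mul C.weight)]
  refine sum_congr rfl fun l _ => ?_
  rw [integral_const_mul, integral_const_mul,
    integral_normTerm_eq (C.ins l).lam (hnum_m l) (hold_m l) (hnum0 l) (hold0 l) (hnumB l) (holdB l) (hden l)]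

end Literature.MathematicalPhysics.QuantumFieldTheory.Balaban1983to89.B15Sect1Statements
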